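import Summits.CriticalPhenomena.CardyFormulaZ2.Theorems.CardyBoundaryCoulombGasHalfPlaneMarkDensityLawBoxExhaustionPart3
import Summits.CriticalPhenomena.CardyFormulaZ2.Theorems.CardyBoundaryCoulombGasHalfPlaneMarkDensityLawBoxExhaustionPart5
import Summits.CriticalPhenomena.CardyFormulaZ2.Theorems.RectilinearCardy.Negative.RectilinearCardyReductions

/-!
# Box exhaustion for the collinear half-plane Cardy statement, part 6: the sandwich at a fixed scale

Support file (line `Sketch`, stub `stub_collinearCardy`, crux `HalfPlaneMarkDensityLaw`,
stmt-CriticalPhenomena-5661; transfer `RectilinearCardy → stub_collinearCardy`).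

* `tendsto_bondDomainCrossingProb_box`: under `RectilinearCardy`, for a conformal rectangle whose
  carrier is an axis-parallel box (an instance of the crux, `isRectilinear_of_carrier_eq`) with a
  uniformizing datum `(φ, u)`, the crossing probabilities along the meshes `t/n` converge to
  `F (crossRatio u)` (one datum suffices, `hasCrossingLimit_iff_tendsto`);
* `eventually_sandwich`: at a fixed scale `t` (box `(-K,K)×(0,H)`, inner marks `t·(a,b,c,y)`, outer
  marks `t·(a-ε',b,c-ε',y)`), for all large `n` the half-plane crossing probability
  `P_{1/2}[A_n ↔ [⌊cn⌋,⌊yn⌋]×{0} in ℤ×ℕ]` is squeezed between `bondDomainCrossingProb R (t/n)` and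
  `bondDomainCrossingProb R⁻ (t/n) + P_{1/2}[Λ_{Mn} ↔ Λ_{MnL}ᶜ]` (parts 2–3);
* `escape_le`: the RSW annulus bound `P_{1/2}[Λ_{Mn} ↔ Λ_{MnL}ᶜ] ≤ C (1/L)^α`
  (tree: `exists_real_boxToFar_le_rpow_of_le_half`).
-/

noncomputable section

namespace Summit.CriticalPhenomena.CardyFormulaZ2.Cruxes.HalfPlaneMarkDensityLaw.SketchLine

open Set Metric MeasureTheory Filter
open Literature.Probability.LatticeModels
open Literature.Probability.Percolation hiding cardyFunction
open Literature.Probability.RandomPlanarGeometry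
open UpperHalfPlane (upperHalfPlaneSet)
open Summit.CriticalPhenomena.CardyFormulaZ2.Theorems.HalfPlaneMarkDensityLaw.Negative
open Summit.CriticalPhenomena.CardyFormulaZ2.Theorems.RectilinearCardy.Negative
  (hasCrossingLimit_iff_tendsto isRectilinear_of_carrier_eq)
open Summit.CriticalPhenomena.CardyFormulaZ2.Theses.CardyBoundaryCoulombGas (RectilinearCardy)
open scoped Topology

namespace BoxExhaustion

/-- **`RectilinearCardy` read on a box along the meshes `t/n`.** [folklore] -/
theorem tendsto_bondDomainCrossingProb_box (hRC : RectilinearCardy) {K H : ℝ} (hK : 0 < K)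
    (hH : 0 < H) (R : ConformalRectangle) (hRc : R.carrier = Ioo (-K) K ×ℂ Ioo 0 H)
    {φ : ConformalEquiv upperHalfPlaneSet R.carrier} {u : Fin 4 → ℝ} (hu : R.IsUniformizing φ u)
    {t : ℝ} (ht : 0 < t) :
    Tendsto (fun n : ℕ => bondDomainCrossingProb R (t / n)) atTop
      (𝓝 (cardyFunction (crossRatio u))) := by
  have hlim : R.HasCrossingLimit (bondDomainCrossingProb R) cardyFunction :=
    hRC R (isRectilinear_of_carrier_eq (by linarith) hH hRc)
  exact tendsto_comp_div_nat ht ((hasCrossingLimit_iff_tendsto hu).1 hlim)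

/-- **The RSW escape bound** at the scales `r = M n`, `R = M n L`: `P_{1/2}[Λ_r ↔ Λ_Rᶜ] ≤ C (1/L)^α`
with the constants of the tree's `exists_real_boxToFar_le_rpow_of_le_half`. [folklore] -/
theorem escape_le {C α : ℝ}
    (hesc : ∀ p : unitInterval, (p : ℝ) ≤ 1 / 2 → ∀ r R : ℕ, 1 ≤ r → r ≤ R →
      (bondPercolation (zdGraph 2) p).real
        {ω | ∃ x ∈ box 2 r, ∃ y ∉ box 2 R, ω ∈ openConnIn Set.univ x y} ≤ C * ((r : ℝ) / R) ^ α)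
    {M n L : ℕ} (hM : 1 ≤ M) (hn : 1 ≤ n) (hL : 1 ≤ L) :
    μ.real {ω | ∃ x ∈ box 2 (M * n), ∃ y ∉ box 2 (M * n * L), ω ∈ openConnIn Set.univ x y} ≤
      C * ((L : ℝ)⁻¹) ^ α := by
  have h := hesc half (by simp) (M * n) (M * n * L) (Nat.one_le_iff_ne_zero.2 (by positivity))
    (Nat.le_mul_of_pos_right _ (by omega))
  have hMn : ((M * n : ℕ) : ℝ) ≠ 0 := by positivity
  have e : (((M * n : ℕ) : ℝ) / ((M * n * L : ℕ) : ℝ)) = (L : ℝ)⁻¹ := by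
    rw [Nat.cast_mul (M * n) L, div_mul_eq_div_div, div_self hMn, one_div]
  rw [e] at h
  exact h

/-- **The sandwich at a fixed scale.** Box `(-K, K) × (0, H)`, scale `t` with `2t < H` and
`t (|m| + 1) < K` for the six marks `m`; `R` has the inner arcs `[ta, tb]`, `[tc, ty]`, `R⁻` the outer
arcs `[t(a-ε'), tb]`, `[t(c-ε'), ty]`; `M = ⌈|a|⌉ + ⌈|b|⌉ + 1`, `L ≥ 1` with `t (M L + 1) < min K H`.
Then for all large `n`: `bondDomainCrossingProb R (t/n) ≤ P_n ≤ bondDomainCrossingProb R⁻ (t/n) +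
P_{1/2}[Λ_{Mn} ↔ Λ_{MnL}ᶜ]`. [folklore] -/
theorem eventually_sandwich {K H t : ℝ} (hK : 0 < K) (ht : 0 < t) (htH : 2 * t < H)
    {a b c y ε' : ℝ} (hab : a ≤ b) (hcy : c ≤ y) (hε' : 0 < ε')
    (ha : t * (|a| + 1) < K) (hb : t * (|b| + 1) < K) (hc : t * (|c| + 1) < K) (hy : t * (|y| + 1) < K)
    (ha' : t * (|a - ε'| + 1) < K) (hc' : t * (|c - ε'| + 1) < K)
    (R : ConformalRectangle) (hRc : R.carrier = Ioo (-K) K ×ℂ Ioo 0 H)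
    (hR0 : R.arc 0 = {z : ℂ | z.im = 0 ∧ z.re ∈ Icc (t * a) (t * b)})
    (hR2 : R.arc 2 = {z : ℂ | z.im = 0 ∧ z.re ∈ Icc (t * c) (t * y)})
    (R' : ConformalRectangle) (hRc' : R'.carrier = Ioo (-K) K ×ℂ Ioo 0 H)
    (hR0' : R'.arc 0 = {z : ℂ | z.im = 0 ∧ z.re ∈ Icc (t * (a - ε')) (t * b)})
    (hR2' : R'.arc 2 = {z : ℂ | z.im = 0 ∧ z.re ∈ Icc (t * (c - ε')) (t * y)})
    {M L : ℕ} (hM : M = ⌈|a|⌉₊ + ⌈|b|⌉₊ + 1) (hL : 1 ≤ L) (hgeo : t * (M * L + 1) < min K H) :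
    ∀ᶠ n : ℕ in atTop,
      bondDomainCrossingProb R (t / n) ≤
          μ.real (openCrossing halfPlane (arcA a b n) (rowIcc ⌊c * n⌋ ⌊y * n⌋)) ∧
        μ.real (openCrossing halfPlane (arcA a b n) (rowIcc ⌊c * n⌋ ⌊y * n⌋)) ≤
          bondDomainCrossingProb R' (t / n) +
            μ.real {ω | ∃ x ∈ box 2 (M * n), ∃ z ∉ box 2 (M * n * L), ω ∈ openConnIn Set.univ x z} := by
  filter_upwards [eventually_ge_atTop (⌈1 / ε'⌉₊ + 1)] with n hn
  have hn1 : 1 ≤ n := by omega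
  have hn0 : 0 < n := hn1
  have hnr : (1 : ℝ) ≤ n := by exact_mod_cast hn1
  have hnpos : (0 : ℝ) < n := by linarith
  -- `t/n ≤ t`
  have hδ : 0 < t / n := div_pos ht hnpos
  have hδt : t / n ≤ t := div_le_self ht.le hnr
  -- `ε' n ≥ 1`
  have hεn : 1 ≤ ε' * n := by
    have h1 : (⌈1 / ε'⌉₊ : ℝ) + 1 ≤ n := by exact_mod_cast hn
    have h2 : 1 / ε' ≤ ⌈1 / ε'⌉₊ := Nat.le_ceil _
    have h3 : 1 / ε' ≤ n := by linarith
    rwa [div_le_iff₀ hε', mul_comm] at h3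
  -- mark inequalities at mesh `t/n`
  have mk : ∀ m : ℝ, t * (|m| + 1) < K → -K < t * m - t / n ∧ t * m + t / n < K := by
    intro m hm
    have h1 : |t * m| = t * |m| := by rw [abs_mul, abs_of_pos ht]
    have h2 := neg_abs_le (t * m)
    have h3 := le_abs_self (t * m)
    constructor <;> nlinarith
  have mk' : ∀ m : ℝ, t * (|m| + 1) < K → -K + t / n ≤ t * m ∧ t * m + t / n ≤ K := by
    intro m hm
    obtain ⟨h1, h2⟩ := mk m hm
    exact ⟨by linarith, h2.le⟩
  have hH2 : 2 * (t / n) < H := by linarith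
  constructor
  · exact bondDomainCrossingProb_box_le hK ht hn0 hab hcy hH2 (mk a ha).1 (mk b hb).2 (mk c hc).1
      (mk y hy).2 R hRc hR0 hR2
  · have haε : (a - ε') * n + 1 ≤ a * n := by nlinarith
    have hcε : (c - ε') * n + 1 ≤ c * n := by nlinarith
    have hr : ∀ m : ℤ, ⌊a * n⌋ ≤ m → m ≤ ⌊b * n⌋ → |m| ≤ ((M * n : ℕ) : ℤ) := by
      intro m h1 h2
      have := abs_le_of_floor_bounds hn1 h1 h2
      rw [hM]; push_cast at this ⊢; linarith
    have hrR : M * n ≤ M * n * L := Nat.le_mul_of_pos_right _ (by omega)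
    have hgeo' : t / n * ((M * n * L : ℕ) + 1) < min K H := by
      have e : t / n * ((M * n * L : ℕ) + 1) = t * (M * L) + t / n := by
        push_cast; field_simp
      rw [e]
      nlinarith
    exact measureReal_openCrossing_halfPlane_le hK ht hn0 haε hcε hH2.le (mk' _ ha').1 (mk' b hb).2
      (mk' _ hc').1 (mk' y hy).2 hr hrR hgeo' R' hRc' hR0' hR2'

end BoxExhaustion

/-- Registered stub of this support file (part 6 of the box exhaustion): `RectilinearCardy` read on an
axis-parallel box along the meshes `t/n`. [folklore] -/
theorem stub_boxExhaustion_boxLimit :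
    RectilinearCardy → ∀ (K H t : ℝ) (R : ConformalRectangle)
      (φ : ConformalEquiv upperHalfPlaneSet R.carrier) (u : Fin 4 → ℝ), 0 < K → 0 < H → 0 < t →
      R.carrier = Ioo (-K) K ×ℂ Ioo 0 H → R.IsUniformizing φ u →
      Tendsto (fun n : ℕ => bondDomainCrossingProb R (t / n)) atTop (𝓝 (cardyFunction (crossRatio u))) :=
  fun hRC _ _ _ R _ _ hK hH ht hRc hu => BoxExhaustion.tendsto_bondDomainCrossingProb_box hRC hK hH R hRc hu ht

end Summit.CriticalPhenomena.CardyFormulaZ2.Cruxes.HalfPlaneMarkDensityLaw.SketchLine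

end
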